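import Summits.ValiantsHypothesis.ValiantsHypothesis.Theses.SuccinctLift

/-!
# `SuccinctLift.Assembly` holds (bookkeeping item 23658 closed by proof)

The assembly item of route `SuccinctLift` (decomp-valiant workshop, lens 2) reads
«`SuccinctPerHardLog3 → UniformityLiftLog3 → ConstantLiftLog3 → CollapseLog3 → VP_ℂ ≠ VNP_ℂ`».
It is pure logic — the same composition as the route's deciding theorem `closes` (which takes the
algebraic-constant lift `AlgConstantLiftLog3` in place of `ConstantLiftLog3`): under `VP ℂ = VNP ℂ`
the collapse `B` yields poly-wire product-depth-`Δ₁` circuits for `per`, and `K (U A)` is exactly the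
statement that no such circuits exist.  Workshop critic, bus 527 (2026-08-30T07:57:31Z), principle
(i): provable-now bookkeeping items are closed by proof, not left open.  No tag, rung or route edge
changes.
-/

set_option linter.dupNamespace false

namespace Summit.ValiantsHypothesis.ValiantsHypothesis.Theorems.SuccinctLiftAssembly

open Literature.Computability.AlgebraicComplexity
open Summit.ValiantsHypothesis.ValiantsHypothesis.Theses.SuccinctLift

/-- **Item 23658 (`SuccinctLift.Assembly`) holds**: `A → U → K → B → VP_ℂ ≠ VNP_ℂ` by composition —
`K (U A)` refutes the depth-`Δ₁` poly-wire circuits for `per` that `B` produces from `VP ℂ = VNP ℂ`.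
[cite: Burgisser2000, Ch. 2 (Def. 2.1–2.2, Rem. 2.11)] -/
theorem assembly_holds :
    Summit.ValiantsHypothesis.ValiantsHypothesis.Theses.SuccinctLift.Assembly := by
  intro hA hU hK hB
  show Literature.Computability.AlgebraicComplexity.VP ℂ ≠
    Literature.Computability.AlgebraicComplexity.VNP ℂ
  intro hEq
  exact hK (hU hA) (hB hEq)

end Summit.ValiantsHypothesis.ValiantsHypothesis.Theorems.SuccinctLiftAssembly
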